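import Summits.HodgeConjecture.HodgeConjecture.Cruxes.BlochSeedDiscOne.SeedCheckerCoherent
import Literature.AlgebraicGeometry.HodgeTheory.ChernCharacterCoherent
import Literature.AlgebraicGeometry.Modules.StrictlyPerfectResolutionOfVBModel
import Literature.AlgebraicGeometry.Modules.BoundedCoherentVBModelsOfRepresentative
import Literature.AlgebraicGeometry.HodgeTheory.HomComplexSigmaWindow
import HarnessLib

/-!
# (B3ᶜ) THE MONAD DOOR — a three-letter complex read through the COHERENT seed checker v19 (hsemireg-monad-4 g12)

Crux `BlochSeedDiscOne` (stmt-HodgeConjecture-18881), cell pub-hsemireg, unit hsemireg-monad-4 g12. Companion memo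
`B3-COHERENT-DOOR-monad4-g12.md`. §1–§5 import Literature only; §6 identifies §2–§4 with the decls of the coherent seed checker
v19∕v20 (`SeedCheckerCoherent.lean`, c5c8-1 g18∕g19: `IsBFSemiregularVia` l.183, `CleanAtSeedCoh` l.347, `Design.CoherentSheafSeedCheck`
l.418, `hasLocallyAlgebraicWeilAnchor_four_one_of_BFcoherent_of_coherentSheafSeedCheck` l.437) and states THE MONAD DOOR.
NOTHING here proves HC ∕ HC_CM ∕ HC_AV ∕ №4 ∕ 26512 ∕ 18881 ∕ rung H2: no letter complex of any design is constructed, and the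
`I`-semiregularity of any such complex — a hypothesis of every door theorem — is OPEN.

## What is proved (sorry-free, no new axiom, no instance, no notation)

Let `L` be a bounded complex of vector bundles on a `ℂ`-scheme `X₀` — for the cell: the LETTER COMPLEX `A →ⁱ N →^q C` of a design,
in degrees `-1, 0, 1`, `q ∘ i = 0`; its DISPLAY SHEAF is `E = H⁰(L) = ker q ∕ im i`.

* §1 `isLE_zero_iff_epi` ∕ `isGE_zero_iff_mono` (any abelian category): for a complex with no terms above degree `1` (resp. below
  `-1`), «cohomologically `≤ 0`» IS `Epi (d⁰ : L⁰ → L¹)` (the sheaf map `q` is onto) and «cohomologically `≥ 0`» IS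
  `Mono (d⁻¹ : L⁻¹ → L⁰)` (the sheaf map `i` is injective): condition (B3ᶜ-P1) «DISPLAY FORM» in sheaf language.
* §2 `chCoh_ofVBModel` (FACT-FREE, any `X₀`): on the strictly perfect resolution `τ^{≤0}L = (⋯ → L⁻¹ → Z⁰L) ↠ H⁰(L)` of the tree's
  `StrictlyPerfectResolution.ofVBModel` (hypotheses `L.IsLE 0 ∧ L.IsGE 0`), the coherent Chern character of the display sheaf is
  `chCoh C X₀ (H⁰L) R k = chPerfect C X₀ L k` in EVERY degree `k` — by `χ(τ^{≤0}L) = χ(L)` in `K₀(X₀)` (tree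
  `IsBoundedVBComplex.eulerChar_truncLE`): no Hartshorne III Ex. 6.9 (b), no support-gap law; and `chPerfect_eq_threeLetters`:
  `chPerfect_k(L) = ch_k(L⁰) − ch_k(L⁻¹) − ch_k(L¹)` = the DESIGN class `ch_k(N) − ch_k(A) − ch_k(C)`.
* §3 `exists_isISemiregularC_truncLE_iff` (any `X₀`, any window): «`H⁰(L)` is `I′`-semiregular read on `τ^{≤0}L` in some window
  `[a′, 0]`» — VERBATIM the body of v19's (C7ᶜ) `IsBFSemiregularVia X₀ (ofVBModel …)` — holds iff the complex `L` ITSELF is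
  `I′`-semiregular (`HomComplex.IsISemiregularC`): tree transport along the quasi-isomorphism `τ^{≤0}L → L`
  (`isISemiregularC_iff_of_quasiIso'`). So for a genuine monad the live row (C7ᶜ) is a statement about `Ext²_D(L, L)` and the Atiyah
  class OF THE LETTER COMPLEX.
* §4 `ClassShape` ∕ `classShape_iff_of_negOnePow` (abstract, Mathlib): the (A1@Z) shape «`κ_p = c_p·hᵖ` (`p ∈ I ∖ {4}`),
  `κ₄ = q·h⁴ + w`» of a degree-indexed family is invariant under `κ_p ↦ (−1)ᵖ κ_p`. Json-level meaning (pen): the DUAL letter complex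
  `L^∨ = (C^∨ → N^∨ → A^∨)` (every divisor negated, roles of `A` and `C` exchanged) has `ch_p(L^∨) = (−1)ᵖ ch_p(L)`, the SAME `ch₄`, the
  SAME `W`-coordinate `μ`; so (B3ᶜ-P2) «DUAL FORM» (`i` injective at every point, `q` generically onto ⟺ `Epi i^∨`, `Mono q^∨`) is
  §1–§3 applied to `L^∨` with unchanged design-side data.
* §5 necessary numerics for (C7ᶜ) on the abelian 8-fold `S⁴` (arithmetic): the target of the full semiregularity map has dimension
  `Σ_q C(8,q)·C(8,q+2) = C(16,6) = 8008`, the window `I = {4}` reads a target of dimension `C(8,3)·C(8,5) = 3136`; with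
  `χ(E,E) = 131072` (the twist ray's `2|μ′|²`, a number OF RECORD — hypothesis here) and Serre symmetry, injectivity of `σ` on `Ext²`
  forces `ext⁴ + 2·hom ≥ 115056 + 2·ext¹ + 2·ext³` (`euler_squeeze`).
* §6 AT THE DOOR v19: `isBFSemiregularVia_ofVBModel_iff` ((C7ᶜ) on `ofVBModel` ⟺ §3), `cleanAtSeedCoh_iff_classShape` (`Iff.rfl`),
  `cleanAtSeedCoh_ofVBModel_iff` ((A1@Z)ᶜ on `ofVBModel` ⟺ the letter class has the shape, by §2), and THE MONAD DOOR
  `coherentSheafSeedCheck_ofVBModel` ∕ `coherentSheafSeedCheck_of_threeLetter` ∕ `hasLocallyAlgebraicWeilAnchor_four_one_of_threeLetter`: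
  (C0′) + `4 ∈ I` + a three-letter complex on `S⁴` with `Epi q`, `Mono i`, `{q | q+1 ∈ I}`-semiregular AS A COMPLEX (OPEN), letter
  class of (A1@Z) shape with `W`-coordinate `μ(D)` ⟹ v19's `Design.CoherentSheafSeedCheck` on (`H⁰ L`, `ofVBModel`); with the
  refereed coherent BF fact ⟹ `HasLocallyAlgebraicWeilAnchor 4 1`.

## References

* [BuchweitzFlenner2003] R.-O. Buchweitz, H. Flenner, *A semiregularity map for modules and applications to deformations*,
  Compositio Math. 137 (2003), §5 Thm. 5.1, Def. 4.1.
* [Fulton1998] W. Fulton, *Intersection Theory*, 2nd ed., §15.1, Example 3.2.3, Remark 3.2.3, Thm. 14.4.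
* [Weibel1994] C. Weibel, *An introduction to homological algebra*, 1.2.7 (truncations), Def. 2.2.4.
* [ThomasonTrobaugh1990] R. W. Thomason, T. Trobaugh, *Higher algebraic K-theory of schemes*, 2.2.x.
* [OkonekSchneiderSpindler1980] C. Okonek, M. Schneider, H. Spindler, *Vector bundles on complex projective spaces*, Ch. II §3 (monads).
-/

open CategoryTheory CategoryTheory.Limits AlgebraicGeometry
open Literature.AlgebraicGeometry Literature.AlgebraicGeometry.Motives Literature.AlgebraicGeometry.HodgeTheory
open Literature.AlgebraicGeometry.Modules Literature.AlgebraicGeometry.KTheory Literature.AlgebraicGeometry.Morphisms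
open Literature.AlgebraicTopology.SingularHomology

set_option linter.dupNamespace false

namespace Summit.HodgeConjecture.HodgeConjecture.Cruxes.BlochSeedDiscOne.MonadDoor

/-! ## §1 (B3ᶜ-P1) in sheaf language: `H¹(L) = 0 ⟺ Epi q`, `H⁻¹(L) = 0 ⟺ Mono i` for a three-letter complex -/

section Cohomology

variable {V : Type*} [Category V] [Abelian V] (K : CochainComplex V ℤ)

/-- For a cochain complex with no terms above degree `1`, «cohomologically `≤ 0`» (`H¹ = 0`) is `Epi (d : K⁰ → K¹)`: for the
letter complex `A → N → C` of a monad in degrees `-1, 0, 1`, the sheaf map `q : N → C` is an epimorphism (onto at every point,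
by Nakayama — pen). [cite: Weibel1994, 1.2.7 (truncations)] [cite: OkonekSchneiderSpindler1980, Ch. II §3 (monads, display)] -/
theorem isLE_zero_iff_epi [K.IsStrictlyLE 1] : K.IsLE 0 ↔ Epi (K.d 0 1) := by
  have hg : (K.sc' 0 1 2).g = 0 := (K.isZero_of_isStrictlyLE 1 2 (by norm_num)).eq_of_tgt _ _
  have h1 : K.ExactAt 1 ↔ Epi (K.d 0 1) := by
    rw [K.exactAt_iff' 0 1 2 (by simp) (by simp), ShortComplex.exact_iff_epi _ hg]
    rfl
  constructor
  · intro h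
    exact h1.1 (K.exactAt_of_isLE 0 1 (by norm_num))
  · intro h
    rw [CochainComplex.isLE_iff]
    intro i hi
    by_cases hi1 : i = 1
    · subst hi1
      exact h1.2 h
    · exact HomologicalComplex.ExactAt.of_isZero (K.isZero_of_isStrictlyLE 1 i (by omega))

/-- For a cochain complex with no terms below degree `-1`, «cohomologically `≥ 0`» (`H⁻¹ = 0`) is `Mono (d : K⁻¹ → K⁰)`: the
sheaf map `i : A → N` is a monomorphism (on an integral base with `A` locally free: injective at the generic point — pen).
[cite: Weibel1994, 1.2.7 (truncations)] [cite: OkonekSchneiderSpindler1980, Ch. II §3 (monads, display)] -/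
theorem isGE_zero_iff_mono [K.IsStrictlyGE (-1)] : K.IsGE 0 ↔ Mono (K.d (-1) 0) := by
  have hf : (K.sc' (-2) (-1) 0).f = 0 := (K.isZero_of_isStrictlyGE (-1) (-2) (by norm_num)).eq_of_src _ _
  have h1 : K.ExactAt (-1) ↔ Mono (K.d (-1) 0) := by
    rw [K.exactAt_iff' (-2) (-1) 0 (by simp) (by simp), ShortComplex.exact_iff_mono _ hf]
    rfl
  constructor
  · intro h
    exact h1.1 (K.exactAt_of_isGE 0 (-1) (by norm_num))
  · intro h
    rw [CochainComplex.isGE_iff]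
    intro i hi
    by_cases hi1 : i = -1
    · subst hi1
      exact h1.2 h
    · exact HomologicalComplex.ExactAt.of_isZero (K.isZero_of_isStrictlyGE (-1) i (by omega))

end Cohomology

/-! ## §2 The class of the display sheaf on `τ^{≤0}L ↠ H⁰(L)` is the letter class — FACT-FREE, every degree -/

section ClassOnVBModel

variable (C : ChernCharacterBetti) (X₀ : SchemeOver ℂ) {L : CochainComplex X₀.left.Modules ℤ}

/-- **`ch_k(H⁰ L) = ch_k(L)` on the resolution `ofVBModel`, every `k`, no fact**: the resolving complex is `τ^{≤0}L`, and
`χ(τ^{≤0}L) = χ(L)` in `K₀(X₀)` because `τ^{≤0}L → L` is a quasi-isomorphism of bounded vector-bundle complexes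
(tree `IsBoundedVBComplex.eulerChar_truncLE`). In particular NO support-gap law and NO Hartshorne III Ex. 6.9 (b) is needed
for the class clause of a monad display whose maps do not degenerate (contrast v19 §19.4 `chCoh_laxMonad`, which treats
`coker q ≠ 0`). [cite: Fulton1998, §15.1 (with App. B.8.3)] [cite: Weibel1994, 1.2.7] -/
theorem chCoh_ofVBModel (hL : IsBoundedVBComplex L) [L.IsLE 0] [L.IsGE 0] {F : X₀.left.Modules}
    (e : L.homology 0 ≅ F) (k : ℕ) :
    chCoh C X₀ F (StrictlyPerfectResolution.ofVBModel hL e) k =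
      Literature.AlgebraicGeometry.HodgeTheory.chPerfect C X₀ L hL.isFiniteLocallyFree k := by
  rw [chCoh_eq_chPerfect]
  change chKZero C X₀ k (eulerChar (L.truncLE 0) (hL.truncLE 0).isFiniteLocallyFree) =
    chKZero C X₀ k (eulerChar L hL.isFiniteLocallyFree)
  rw [hL.eulerChar_truncLE 0]

/-- **The letter class**: for a vector-bundle complex in degrees `-1, 0, 1`,
`ch_k(L) = ch_k(L⁰) − ch_k(L⁻¹) − ch_k(L¹)` (`= ch_k(N) − ch_k(A) − ch_k(C)` for the letter complex of a design).
[cite: Fulton1998, §15.1 and Example 3.2.3] -/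
theorem chPerfect_eq_threeLetters (hL : ∀ i, IsFiniteLocallyFree (L.X i)) [L.IsStrictlyGE (-1)] [L.IsStrictlyLE 1]
    (k : ℕ) :
    Literature.AlgebraicGeometry.HodgeTheory.chPerfect C X₀ L hL k =
      C.ch X₀ (L.X 0) k - C.ch X₀ (L.X (-1)) k - C.ch X₀ (L.X 1) k := by
  have hs : ∀ i ∉ ({-1, 0, 1} : Finset ℤ), IsZero (L.X i) := by
    intro i hi
    simp only [Finset.mem_insert, Finset.mem_singleton, not_or] at hi
    by_cases h : i < -1
    · exact L.isZero_of_isStrictlyGE (-1) i h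
    · exact L.isZero_of_isStrictlyLE 1 i (by omega)
  rw [Literature.AlgebraicGeometry.HodgeTheory.chPerfect_eq_sum C X₀ L hL _ hs,
    Finset.sum_insert (by simp), Finset.sum_insert (by simp), Finset.sum_singleton]
  have h1 : Int.negOnePow (-1) = -1 := by rw [Int.negOnePow_neg, Int.negOnePow_one]
  rw [h1, Int.negOnePow_zero, Int.negOnePow_one]
  simp only [Units.val_neg, Units.val_one, neg_smul, one_smul]
  abel

/-- Hence, FACT-FREE and in every degree: the display sheaf of a three-letter complex with `H^{≠0} = 0` has the design class
on the resolution `ofVBModel`. [cite: Fulton1998, §15.1] -/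
theorem chCoh_ofVBModel_eq_threeLetters (hL : IsBoundedVBComplex L) [L.IsLE 0] [L.IsGE 0] [L.IsStrictlyGE (-1)]
    [L.IsStrictlyLE 1] {F : X₀.left.Modules} (e : L.homology 0 ≅ F) (k : ℕ) :
    chCoh C X₀ F (StrictlyPerfectResolution.ofVBModel hL e) k =
      C.ch X₀ (L.X 0) k - C.ch X₀ (L.X (-1)) k - C.ch X₀ (L.X 1) k := by
  rw [chCoh_ofVBModel, chPerfect_eq_threeLetters]

end ClassOnVBModel

/-! ## §3 (C7ᶜ) read on `τ^{≤0}L` IS `I′`-semiregularity of the letter complex -/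

section Transfer

variable (X₀ : SchemeOver ℂ) [HasDerivedCategory X₀.left.Modules] {L : CochainComplex X₀.left.Modules ℤ}

/-- **Window-by-window transfer**: `τ^{≤0}L` (window `[a′, 0]`) is `I′`-semiregular iff `L` (window `[a, b]`) is — transport of
`σ` along the quasi-isomorphism `ιTruncLE : τ^{≤0}L → L` (`L` cohomologically `≤ 0`). [cite: BuchweitzFlenner2003, §5 (I-semiregular)] -/
theorem isISemiregularC_truncLE_iff (hL : IsBoundedVBComplex L) [L.IsLE 0] (a' a b : ℤ) [(L.truncLE 0).IsStrictlyGE a']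
    [L.IsStrictlyGE a] [L.IsStrictlyLE b] (I' : Set ℕ) :
    Literature.AlgebraicGeometry.HodgeTheory.HomComplex.IsISemiregularC X₀ (L.truncLE 0) a' 0
        (hL.truncLE 0).isFiniteLocallyFree I' ↔
      Literature.AlgebraicGeometry.HodgeTheory.HomComplex.IsISemiregularC X₀ L a b hL.isFiniteLocallyFree I' :=
  Literature.AlgebraicGeometry.HodgeTheory.HomComplex.isISemiregularC_iff_of_quasiIso' X₀ a' 0 a b
    (hL.truncLE 0).isFiniteLocallyFree hL.isFiniteLocallyFree (L.ιTruncLE 0) I'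

/-- **Semiregularity transfer to the letters** — VERBATIM the body of v19's `IsBFSemiregularVia X₀ (ofVBModel hL e) I` (whose
resolving complex is `τ^{≤0}L`, `StrictlyPerfectResolution.ofVBModel_P`) on the left: «for some window `[a′, 0]` containing
`τ^{≤0}L`, the complex `τ^{≤0}L` is `I′`-semiregular» iff the letter complex `L` is `I′`-semiregular in its own window.
[cite: BuchweitzFlenner2003, §5 (I-semiregular) and Def. 4.1] -/
theorem exists_isISemiregularC_truncLE_iff (hL : IsBoundedVBComplex L) [L.IsLE 0] (a b : ℤ) [L.IsStrictlyGE a]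
    [L.IsStrictlyLE b] (I' : Set ℕ) :
    (∃ (a' : ℤ) (_ : (L.truncLE 0).IsStrictlyGE a'),
        Literature.AlgebraicGeometry.HodgeTheory.HomComplex.IsISemiregularC X₀ (L.truncLE 0) a' 0
          (hL.truncLE 0).isFiniteLocallyFree I') ↔
      Literature.AlgebraicGeometry.HodgeTheory.HomComplex.IsISemiregularC X₀ L a b hL.isFiniteLocallyFree I' := by
  have hGE : (L.truncLE 0).IsStrictlyGE a := isStrictlyGE_truncLE L a 0
  constructor
  · rintro ⟨a', ha', h⟩
    exact (isISemiregularC_truncLE_iff X₀ hL a' a b I').1 h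
  · intro h
    exact ⟨a, hGE, (isISemiregularC_truncLE_iff X₀ hL a a b I').2 h⟩

end Transfer

/-! ## §4 The (A1@Z) shape of a degree-indexed family and its sign invariance (dual form) -/

section Shape

variable {V : ℕ → Type*} [∀ p, AddCommGroup (V p)] [∀ p, Module ℂ (V p)]

/-- **(A1@Z) SHAPE** of a degree-indexed family `κ` in the window `I` against the powers `hp p = hᵖ` of a polarisation class and a
Weil class `w` in degree `4`: `κ_p = c_p·hᵖ` for `p ∈ I ∖ {4}` (rational `c_p`) and `κ₄ = q·h⁴ + w`. v19's `CleanAtSeedCoh C I F h 𝓔 R μ`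
is this shape for `κ = chCoh C S⁴ 𝓔 R`, `hp = cupPowTwo h`, `w = F.wOf μ` (§6 `cleanAtSeedCoh_iff_classShape`, `Iff.rfl`). A PREDICATE (the
hypothesis «`α_p(0) = ch_p(ℰ_0)`, `p ∈ I`» of BF Thm. 5.1 in the cell's (A1@Z) normal form), nothing asserted.
[cite: BuchweitzFlenner2003, §5 Thm. 5.1] -/
def ClassShape (I : Finset ℕ) (hp : (p : ℕ) → V p) (w : V 4) (κ : (p : ℕ) → V p) : Prop :=
  ∃ (c : ℕ → ℚ) (q : ℚ), (∀ p ∈ I, p ≠ 4 → κ p = ((c p : ℚ) : ℂ) • hp p) ∧ κ 4 = ((q : ℚ) : ℂ) • hp 4 + w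

/-- `(−1)ᵖ · (−1)ᵖ · x = x`. -/
private theorem negOnePow_smul_negOnePow_smul {M : Type*} [AddCommGroup M] [Module ℂ M] (p : ℕ) (x : M) :
    ((-1 : ℂ) ^ p) • ((-1 : ℂ) ^ p) • x = x := by
  rw [smul_smul, ← mul_pow, neg_mul_neg, one_mul, one_pow, one_smul]

/-- One direction of the sign flip. -/
private theorem classShape_of_negOnePow {I : Finset ℕ} {hp : (p : ℕ) → V p} {w : V 4} (κ₁ κ₂ : (p : ℕ) → V p)
    (h12 : ∀ p, κ₂ p = ((-1 : ℂ) ^ p) • κ₁ p) (h : ClassShape I hp w κ₁) : ClassShape I hp w κ₂ := by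
  obtain ⟨c, q, hc, hq⟩ := h
  have h4 : κ₂ 4 = κ₁ 4 := by rw [h12]; norm_num
  refine ⟨fun p => (-1) ^ p * c p, q, fun p hpI hp4 => ?_, by rw [h4, hq]⟩
  rw [h12, hc p hpI hp4, smul_smul]
  congr 1
  push_cast
  ring

/-- **The (A1@Z) shape is invariant under `κ_p ↦ (−1)ᵖ κ_p`** (degree `4` is even; the rational coefficients absorb the sign).
Json-level reading (pen): the DUAL letter complex `L^∨ = (C^∨ → N^∨ → A^∨)` has `ch_p(L^∨) = (−1)ᵖ ch_p(L)`, hence the same `ch₄`,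
the same `μ`, and is letter-clean iff `L` is; the DUAL FORM (B3ᶜ-P2) is §1–§3 applied to `L^∨`.
[cite: Fulton1998, Remark 3.2.3 (a) (`c_i(E^∨) = (−1)^i c_i(E)`) and Example 3.2.3] -/
theorem classShape_iff_of_negOnePow {I : Finset ℕ} {hp : (p : ℕ) → V p} {w : V 4} (κ κ' : (p : ℕ) → V p)
    (hκ : ∀ p, κ' p = ((-1 : ℂ) ^ p) • κ p) : ClassShape I hp w κ' ↔ ClassShape I hp w κ := by
  have hκ' : ∀ p, κ p = ((-1 : ℂ) ^ p) • κ' p := fun p => by rw [hκ, negOnePow_smul_negOnePow_smul]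
  exact ⟨classShape_of_negOnePow κ' κ hκ', classShape_of_negOnePow κ κ' hκ⟩

/-- The shape only reads the window: families agreeing on `I` (and at `4`) have the same shape — e.g. the display sheaf of a
LAX monad (`coker q` supported in codimension `> max I`) vs. the letter class, v19 `chCoh_laxMonad_window`. -/
theorem classShape_congr {I : Finset ℕ} {hp : (p : ℕ) → V p} {w : V 4} (κ κ' : (p : ℕ) → V p)
    (hI : ∀ p ∈ I, κ' p = κ p) (h4 : κ' 4 = κ 4) : ClassShape I hp w κ' ↔ ClassShape I hp w κ := by
  constructor
  · rintro ⟨c, q, hc, hq⟩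
    exact ⟨c, q, fun p hp hp4 => by rw [← hI p hp, hc p hp hp4], by rw [← h4, hq]⟩
  · rintro ⟨c, q, hc, hq⟩
    exact ⟨c, q, fun p hp hp4 => by rw [hI p hp, hc p hp hp4], by rw [h4, hq]⟩

end Shape

/-! ## §5 Necessary numerics for (C7ᶜ) on the 8-fold `S⁴` (arithmetic only) -/

section Budget

/-- Dimension of the target `⊕_{q=0}^{6} H^{q+2}(S⁴, Ωᵠ)` of the full semiregularity map on a complex abelian 8-fold
(`h^{q, q+2} = C(8,q)·C(8,q+2)`): `8008`. [cite: BuchweitzFlenner2003, Def. 4.1] -/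
theorem sigma_target_dim_full : ∑ q ∈ Finset.range 7, Nat.choose 8 q * Nat.choose 8 (q + 2) = 8008 := by
  decide

/-- Vandermonde form of the same number: `C(16, 6) = 8008`. -/
theorem sigma_target_dim_full' : Nat.choose 16 6 = 8008 := by
  decide

/-- The window `I = {4}` reads `σ₃ : Ext² → H⁵(Ω³)`, target dimension `C(8,3)·C(8,5) = 3136`. [cite: BuchweitzFlenner2003, Def. 4.1] -/
theorem sigma_target_dim_four : Nat.choose 8 3 * Nat.choose 8 5 = 3136 := by
  decide

/-- **Euler squeeze** (necessary condition, arithmetic): with `eᵢ = dim Extⁱ(E, E)` on an 8-fold, Serre symmetry `eᵢ = e₈₋ᵢ`,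
`χ(E, E) = Σ (−1)ⁱ eᵢ = 131072` (the twist ray's `2|μ′|²`, |μ′| = 256 — a number OF RECORD, hypothesis here) and the injectivity
bound `e₂ ≤ 8008` forced by full-window semiregularity: `e₄ + 2e₀ ≥ 115056 + 2e₁ + 2e₃`. [cite: BuchweitzFlenner2003, Def. 4.1] -/
theorem euler_squeeze (e : ℕ → ℤ) (h8 : e 8 = e 0) (h7 : e 7 = e 1) (h6 : e 6 = e 2) (h5 : e 5 = e 3)
    (hχ : e 0 - e 1 + e 2 - e 3 + e 4 - e 5 + e 6 - e 7 + e 8 = 131072) (h2 : e 2 ≤ 8008) :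
    115056 + 2 * e 1 + 2 * e 3 ≤ e 4 + 2 * e 0 := by
  omega

/-- The same squeeze in the window `I = {4}` (`e₂ ≤ 3136`): `e₄ + 2e₀ ≥ 124800 + 2e₁ + 2e₃`. -/
theorem euler_squeeze_four (e : ℕ → ℤ) (h8 : e 8 = e 0) (h7 : e 7 = e 1) (h6 : e 6 = e 2) (h5 : e 5 = e 3)
    (hχ : e 0 - e 1 + e 2 - e 3 + e 4 - e 5 + e 6 - e 7 + e 8 = 131072) (h2 : e 2 ≤ 3136) :
    124800 + 2 * e 1 + 2 * e 3 ≤ e 4 + 2 * e 0 := by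
  omega

end Budget

open Summit.HodgeConjecture.HodgeConjecture.Cruxes.BlochSeedDiscOne.SeedChecker
open Summit.HodgeConjecture.HodgeConjecture.Cruxes.BlochSeedDiscOne.Anchor
open Summit.Ventures.HSemireg Summit.Ventures.HSemireg.Pad4Tower
open Summit.HodgeConjecture.HodgeConjecture.WeilTypeLadder

/-! ## §6 AT THE DOOR v19

### §6.1 (C7ᶜ) on `ofVBModel` is `I′`-semiregularity of the letter complex -/

section TransferV19

variable (X₀ : SchemeOver ℂ) {L : CochainComplex X₀.left.Modules ℤ}

/-- **Semiregularity transfer to the letters (v19 form)**: for a bounded vector-bundle complex `L` with cohomology only in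
degree `0`, in any window `[a, b]`, v19's (C7ᶜ) `IsBFSemiregularVia X₀ (ofVBModel hL e) I` holds iff `L` ITSELF is
`{q | q+1 ∈ I}`-semiregular (`HomComplex.IsISemiregularC`). [cite: BuchweitzFlenner2003, §5 (I-semiregular) and Def. 4.1] -/
theorem isBFSemiregularVia_ofVBModel_iff (hL : IsBoundedVBComplex L) [L.IsLE 0] [L.IsGE 0] (a b : ℤ)
    [L.IsStrictlyGE a] [L.IsStrictlyLE b] {F : X₀.left.Modules} (e : L.homology 0 ≅ F) (I : Finset ℕ) :
    IsBFSemiregularVia X₀ (StrictlyPerfectResolution.ofVBModel hL e) I ↔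
      letI := HasDerivedCategory.standard X₀.left.Modules
      Literature.AlgebraicGeometry.HodgeTheory.HomComplex.IsISemiregularC X₀ L a b hL.isFiniteLocallyFree
        {q | q + 1 ∈ I} := by
  letI := HasDerivedCategory.standard X₀.left.Modules
  exact exists_isISemiregularC_truncLE_iff X₀ hL a b {q | q + 1 ∈ I}

end TransferV19

/-! ### §6.2 (A1@Z)ᶜ on `ofVBModel` is the shape of the letter class -/

section Clean

variable {E₀ : AbelianVariety ℂ} {ψ₀ : E₀ ⟶ E₀}

/-- v19's `CleanAtSeedCoh` IS the (A1@Z) shape of the family `chCoh C S⁴ 𝓔 R` (definitional). [cite: BuchweitzFlenner2003, §5 Thm. 5.1] -/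
theorem cleanAtSeedCoh_iff_classShape (C : ChernCharacterBetti) (I : Finset ℕ) (F : WeilFrame E₀ ψ₀)
    (h : complexBetti (pad4Anchor E₀).X 2) (𝓔 : (pad4Anchor E₀).X.left.Modules) (R : StrictlyPerfectResolution 𝓔)
    (μ : GaussianInt) :
    CleanAtSeedCoh C I F h 𝓔 R μ ↔ ClassShape I (cupPowTwo h) (F.wOf μ) (chCoh C (pad4Anchor E₀).X 𝓔 R) :=
  Iff.rfl

/-- **(A1@Z)ᶜ of the display sheaf on `ofVBModel` IS letter-cleanliness** (§2 `chCoh_ofVBModel`; fact-free).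
[cite: Fulton1998, §15.1] -/
theorem cleanAtSeedCoh_ofVBModel_iff (C : ChernCharacterBetti) (I : Finset ℕ) (F : WeilFrame E₀ ψ₀)
    (h : complexBetti (pad4Anchor E₀).X 2) {L : CochainComplex (pad4Anchor E₀).X.left.Modules ℤ}
    (hL : IsBoundedVBComplex L) [L.IsLE 0] [L.IsGE 0] {𝓔 : (pad4Anchor E₀).X.left.Modules} (e : L.homology 0 ≅ 𝓔)
    (μ : GaussianInt) :
    CleanAtSeedCoh C I F h 𝓔 (StrictlyPerfectResolution.ofVBModel hL e) μ ↔
      ClassShape I (cupPowTwo h) (F.wOf μ)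
        (Literature.AlgebraicGeometry.HodgeTheory.chPerfect C (pad4Anchor E₀).X L hL.isFiniteLocallyFree) := by
  rw [cleanAtSeedCoh_iff_classShape]
  exact classShape_congr _ _ (fun p _ => chCoh_ofVBModel C _ hL e p) (chCoh_ofVBModel C _ hL e 4)

end Clean

/-! ### §6.3 THE MONAD DOOR on `S⁴` -/

section Door

variable {E₀ : AbelianVariety ℂ} {ψ₀ : E₀ ⟶ E₀} {C : ChernCharacterBetti} {I : Finset ℕ}
  {L : CochainComplex (pad4Anchor E₀).X.left.Modules ℤ}

/-- **THE MONAD DOOR (vector-bundle model form).** A design `D` with (C0′), a window `I ∋ 4`, a bounded vector-bundle complex `L`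
on `S⁴` with cohomology only in degree `0`, `{q | q+1 ∈ I}`-semiregular AS A COMPLEX (OPEN for every design of record) and whose
class `chPerfect(L)` has the (A1@Z) shape with `W`-coordinate `μ(D)` against `h_std` ⟹ the pair (display sheaf `H⁰(L) ≅ 𝓔`,
resolution `τ^{≤0}L`) PASSES v19's coherent seed checker. HC ∕ 18881 NOT proved. [cite: BuchweitzFlenner2003, §5 Thm. 5.1 (hypotheses)] -/
theorem coherentSheafSeedCheck_ofVBModel {D : SeedChecker.Design} {K : AnchorKit E₀ ψ₀} (hL : IsBoundedVBComplex L)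
    [L.IsLE 0] [L.IsGE 0] (a b : ℤ) [L.IsStrictlyGE a] [L.IsStrictlyLE b] {𝓔 : (pad4Anchor E₀).X.left.Modules}
    (e : L.homology 0 ≅ 𝓔) (hC0 : D.ClassDataRankFree) (h4 : 4 ∈ I)
    (hsr : letI := HasDerivedCategory.standard (pad4Anchor E₀).X.left.Modules
      Literature.AlgebraicGeometry.HodgeTheory.HomComplex.IsISemiregularC (pad4Anchor E₀).X L a b
        hL.isFiniteLocallyFree {q | q + 1 ∈ I})
    (hcl : ClassShape I (cupPowTwo (hStd E₀ K.η)) (K.F.wOf D.mu)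
      (Literature.AlgebraicGeometry.HodgeTheory.chPerfect C (pad4Anchor E₀).X L hL.isFiniteLocallyFree)) :
    D.CoherentSheafSeedCheck C I K 𝓔 (StrictlyPerfectResolution.ofVBModel hL e) :=
  ⟨hC0, h4, (isBFSemiregularVia_ofVBModel_iff (pad4Anchor E₀).X hL a b e I).2 hsr,
    (cleanAtSeedCoh_ofVBModel_iff C I K.F (hStd E₀ K.η) hL e D.mu).2 hcl⟩

/-- **THE MONAD DOOR (three-letter form; (B3ᶜ-P1) explicit).** `L = (A →ⁱ N →^q C)` in degrees `-1, 0, 1` on `S⁴` with `q` an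
EPIMORPHISM and `i` a MONOMORPHISM of sheaves, `{q | q+1 ∈ I}`-semiregular as a complex (OPEN), and letter class
`ch(N) − ch(A) − ch(C)` of (A1@Z) shape in `I ∋ 4` with `W`-coordinate `μ(D)` ⟹ (display sheaf `ker q ∕ im i = H⁰(L)`, resolution
`A → ker q`) passes v19's coherent seed checker. [cite: BuchweitzFlenner2003, §5 Thm. 5.1 (hypotheses)]
[cite: OkonekSchneiderSpindler1980, Ch. II §3 (monads, display)] -/
theorem coherentSheafSeedCheck_of_threeLetter {D : SeedChecker.Design} {K : AnchorKit E₀ ψ₀} (hL : IsBoundedVBComplex L)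
    [L.IsStrictlyGE (-1)] [L.IsStrictlyLE 1] (hq : Epi (L.d 0 1)) (hi : Mono (L.d (-1) 0))
    (hC0 : D.ClassDataRankFree) (h4 : 4 ∈ I)
    (hsr : letI := HasDerivedCategory.standard (pad4Anchor E₀).X.left.Modules
      Literature.AlgebraicGeometry.HodgeTheory.HomComplex.IsISemiregularC (pad4Anchor E₀).X L (-1) 1
        hL.isFiniteLocallyFree {q | q + 1 ∈ I})
    (hcl : ClassShape I (cupPowTwo (hStd E₀ K.η)) (K.F.wOf D.mu)
      (fun p => C.ch (pad4Anchor E₀).X (L.X 0) p - C.ch (pad4Anchor E₀).X (L.X (-1)) p - C.ch (pad4Anchor E₀).X (L.X 1) p)) :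
    ∃ (_ : L.IsLE 0) (_ : L.IsGE 0),
      D.CoherentSheafSeedCheck C I K (L.homology 0) (StrictlyPerfectResolution.ofVBModel hL (Iso.refl _)) := by
  haveI : L.IsLE 0 := (isLE_zero_iff_epi L).2 hq
  haveI : L.IsGE 0 := (isGE_zero_iff_mono L).2 hi
  refine ⟨inferInstance, inferInstance, coherentSheafSeedCheck_ofVBModel hL (-1) 1 (Iso.refl _) hC0 h4 hsr ?_⟩
  exact (classShape_congr _ _ (fun p _ => chPerfect_eq_threeLetters C _ hL.isFiniteLocallyFree p)
    (chPerfect_eq_threeLetters C _ hL.isFiniteLocallyFree 4)).2 hcl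

/-- **End to end (the `d = 1` local input of the rung)**: a three-letter complex as above on the pad-4 anchor of a CM curve
`(E₀, ψ₀)`, `ψ₀² = −1`, plus the REFEREED coherent Buchweitz–Flenner Thm. 5.1 ⟹ `HasLocallyAlgebraicWeilAnchor 4 1`. The
semiregularity of the letter complex is the OPEN hypothesis; no such complex is exhibited. HC ∕ HC_AV ∕ 18881 NOT proved.
[cite: BuchweitzFlenner2003, §5 Thm. 5.1] -/
theorem hasLocallyAlgebraicWeilAnchor_four_one_of_threeLetter
    (hBF : BuchweitzFlenner2003_variationalHodge_ISemiregular_coherent) (hE : E₀.dim = 1)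
    (hψ : ψ₀ ≫ ψ₀ = -(1 • 𝟙 E₀)) {D : SeedChecker.Design} {K : AnchorKit E₀ ψ₀} (hL : IsBoundedVBComplex L)
    [L.IsStrictlyGE (-1)] [L.IsStrictlyLE 1] (hq : Epi (L.d 0 1)) (hi : Mono (L.d (-1) 0))
    (hC0 : D.ClassDataRankFree) (h4 : 4 ∈ I)
    (hsr : letI := HasDerivedCategory.standard (pad4Anchor E₀).X.left.Modules
      Literature.AlgebraicGeometry.HodgeTheory.HomComplex.IsISemiregularC (pad4Anchor E₀).X L (-1) 1
        hL.isFiniteLocallyFree {q | q + 1 ∈ I})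
    (hcl : ClassShape I (cupPowTwo (hStd E₀ K.η)) (K.F.wOf D.mu)
      (fun p => C.ch (pad4Anchor E₀).X (L.X 0) p - C.ch (pad4Anchor E₀).X (L.X (-1)) p - C.ch (pad4Anchor E₀).X (L.X 1) p)) :
    HasLocallyAlgebraicWeilAnchor 4 1 := by
  obtain ⟨_, _, h⟩ := coherentSheafSeedCheck_of_threeLetter hL hq hi hC0 h4 hsr hcl
  exact hasLocallyAlgebraicWeilAnchor_four_one_of_BFcoherent_of_coherentSheafSeedCheck hBF hE hψ h

end Door

end Summit.HodgeConjecture.HodgeConjecture.Cruxes.BlochSeedDiscOne.MonadDoor
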